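import Literature.MathematicalPhysics.KineticTheory.HardSphereEulerProofs
import HarnessLib

/-!
# Vocabulary of the line `visit-ledger-upscattering` for the crux `AprioriBounds`
(stmt-AtomisticToContinuum-9519; rank 5 of route `CollisionIsometryCLT`, rank 4 of
`StiffCollisionalRelaxation`; the two route decls are syntactically the same `Prop`)

Definitions-only support file (`--supports stmt-AtomisticToContinuum-9519`) of the lead prover of the
line (`Cruxes/AprioriBounds/Lines/visit_ledger_upscattering.lean`, planner
`planner-cruxplan-stmt-AtomisticToContinuum-9519-visit-ledger-upscatt-0`; skeleton registered on the
item by the lead with the seven stubs `stub_initialMoment`, `stub_speedCap`, `stub_upscatterBulk`,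
`stub_recollision`, `stub_tiling`, `stub_ledger`, `stub_chamber` — the lead's reshape splits the
planner's `stub_ledger` into its pathwise half `stub_tiling` and its probabilistic half). It makes
the line's vocabulary IMPORTABLE so that each registered stub can land in its own sorry-free
Theorems file with the registered signature verbatim: the types `Cfg, Flow, Flows`, the profile
hypothesis `NiceProfiles`, the ledger's objects (`nu` the collision clock, `ownColl` own-collision
times, `sojourn`, `postE` outgoing energy, `entrySet`, `shellSet`, `shellCount`, `entryWeight`,
`energeticLedger`), the pathwise `TilingBound`, and the five in-probability events of the line
(`InitAt`, `CapAt`, `BulkAt`, `RecollAt`, `TimeAvgAt` — the last is verbatim the crux's component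
(i) event at a given rate and constant). All bodies are copied byte-for-byte from the registered
skeleton; nothing is asserted here (every `def … : Prop` is a predicate the stubs prove or consume,
never a hypothesis taken as a fact).

The mathematics (idea card `visit-ledger-upscattering`, triage r1 pass ×3): between two of its own
collisions a sphere's speed is constant, so `∫₀ᵗ (N+1)⁻¹Σᵢ e^{λ|vᵢ(s)|²} ds` is an exact sum over
visits — initial flights (priced statically, `InitAt`), thermal entries (`≤ e^{λK₀} t` by tiling) and
the energetic ledger `Σ_{entries, E ≥ K₀} e^{λE}·soj`, controlled by the speed cap (`CapAt`), the
shell-count domination (`BulkAt`) and the weighted re-collision statistic (`RecollAt`), in which the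
collision clock `ν_N = σ²(N+1)^{1/3}` cancels.
-/

noncomputable section

open MeasureTheory Filter Set Topology
open scoped ENNReal BigOperators

namespace Summit.AtomisticToContinuum.HydrodynamicLimit.Theorems.VisitLedgerUpscattering

open Literature.MathematicalPhysics.KineticTheory Literature.Analysis.FluidPDE

/-! ## Types (the crux's) -/

/-- Phase space of `N + 1` spheres on `𝕋³` (the crux's configuration type). -/
abbrev Cfg (N : ℕ) : Type := Config (N + 1) (Fin 3) T3

/-- A hard-sphere flow of `N + 1` spheres of diameter `hsDiameter σ N = σ (N+1)^{-1/3}` on `𝕋³`. -/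
abbrev Flow (σ : ℝ) (N : ℕ) : Type :=
  HardSphereFlow (Torus.geometry (Fin 3)) (hsDiameter σ N) (N + 1)

/-- Families of flows (the crux's `Φ`). -/
abbrev Flows (σ : ℝ) : Type := (N : ℕ) → Flow σ N

/-- The crux's profile hypotheses: continuous activity, temperature and velocity profiles with
`a₀ > 0`, `θ₀ > 0`. -/
def NiceProfiles (a₀ θ₀ : T3 → ℝ) (u₀ : T3 → V3) : Prop :=
  Continuous a₀ ∧ Continuous θ₀ ∧ Continuous u₀ ∧ (∀ x, 0 < a₀ x) ∧ (∀ x, 0 < θ₀ x)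

/-! ## The ledger's objects -/

/-- The collision clock `ν_N = σ² (N+1)^{1/3}` (mean-free-time⁻¹ scale at fixed reduced density:
`(N+1)` spheres of cross-section `≍ ε_N² = σ²(N+1)^{-2/3}` in unit volume). -/
def nu (σ : ℝ) (N : ℕ) : ℝ := σ ^ 2 * ((N + 1 : ℕ) : ℝ) ^ (1 / 3 : ℝ)

/-- OWN-collision times of sphere `i` along the orbit of `z`: times at which `i` is in contact with
some `j ≠ i` (on good orbits these are exactly the collision times involving `i`:
`IsHardSphereTrajectory.binary`). -/
def ownColl (σ : ℝ) (N : ℕ) (Φ : Flow σ N) (z : Cfg N) (i : Fin (N + 1)) : Set ℝ :=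
  {τ | ∃ j : Fin (N + 1), j ≠ i ∧
    (Φ.flow τ z ∈ contactSet (Torus.geometry (Fin 3)) (N + 1) (hsDiameter σ N) i j ∨
      Φ.flow τ z ∈ contactSet (Torus.geometry (Fin 3)) (N + 1) (hsDiameter σ N) j i)}

/-- SOJOURN after time `τ` of sphere `i`, capped at the horizon `t`: the time to the next own
collision of `i` after `τ` (or to `t`, whichever comes first) — the length of the flight of `i` that
starts at `τ`, seen inside `[0,t]`. -/
def sojourn (σ : ℝ) (N : ℕ) (Φ : Flow σ N) (z : Cfg N) (t τ : ℝ) (i : Fin (N + 1)) : ℝ :=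
  min (sInf ((ownColl σ N Φ z i ∩ Ioi τ) ∪ {t})) t - τ

/-- OUTGOING (post-collisional) energy of sphere `i` at time `τ`: `|vᵢ(τ)|²` (the flow is
right-continuous at collisions, so at an own-collision time this is the energy `i` flies on with). -/
def postE (σ : ℝ) (N : ℕ) (Φ : Flow σ N) (z : Cfg N) (τ : ℝ) (i : Fin (N + 1)) : ℝ :=
  ‖(Φ.flow τ z i).2‖ ^ 2

/-- ENERGETIC ENTRIES in `(0,t]` at threshold `K₀`: pairs `(τ, i)` with `τ` an own-collision time of
`i` in `(0,t]` and outgoing energy `≥ K₀` (a finite set on good orbits: locally finite collisions). -/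
def entrySet (σ : ℝ) (N : ℕ) (Φ : Flow σ N) (z : Cfg N) (t : ℝ) (K₀ : ℕ) :
    Set (ℝ × Fin (N + 1)) :=
  {p | p.1 ∈ ownColl σ N Φ z p.2 ∩ Ioc 0 t ∧ (K₀ : ℝ) ≤ postE σ N Φ z p.1 p.2}

/-- Entries in `(0,t]` into the unit energy SHELL `[K, K+1)`. -/
def shellSet (σ : ℝ) (N : ℕ) (Φ : Flow σ N) (z : Cfg N) (t : ℝ) (K : ℕ) :
    Set (ℝ × Fin (N + 1)) :=
  {p | p.1 ∈ ownColl σ N Φ z p.2 ∩ Ioc 0 t ∧ postE σ N Φ z p.1 p.2 ∈ Ico (K : ℝ) ((K : ℝ) + 1)}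

/-- The SHELL COUNT `count_K` (`Set.ncard`; junk `0` off the good set, a null set). -/
def shellCount (σ : ℝ) (N : ℕ) (Φ : Flow σ N) (z : Cfg N) (t : ℝ) (K : ℕ) : ℕ :=
  (shellSet σ N Φ z t K).ncard

/-- The ENTRY WEIGHT `W_λ = Σ_{energetic entries} e^{λE}` (`finsum`; a genuine finite sum on good
orbits). -/
def entryWeight (σ : ℝ) (N : ℕ) (Φ : Flow σ N) (z : Cfg N) (t : ℝ) (K₀ : ℕ) (lam : ℝ) : ℝ :=
  ∑ᶠ p ∈ entrySet σ N Φ z t K₀, Real.exp (lam * postE σ N Φ z p.1 p.2)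

/-- The ENERGETIC LEDGER `L_λ = Σ_{energetic entries} e^{λE}·soj`. -/
def energeticLedger (σ : ℝ) (N : ℕ) (Φ : Flow σ N) (z : Cfg N) (t : ℝ) (K₀ : ℕ) (lam : ℝ) : ℝ :=
  ∑ᶠ p ∈ entrySet σ N Φ z t K₀,
    Real.exp (lam * postE σ N Φ z p.1 p.2) * sojourn σ N Φ z t p.1 p.2

/-! ## The pathwise tiling bound (B2 of the idea card, stated on the good set of ONE flow) -/

/-- **Tiling bound** for one flow `Φ` of `N + 1` spheres, horizon `t`, threshold `K₀` and rate
`lam`: on every good orbit the time integral over `[0,t]` of the empirical exponential moment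
`(N+1)⁻¹Σᵢ e^{λ|vᵢ(s)|²}` is at most (initial flights) `t ·` its time-zero value `+` (thermal
entries, outgoing energy `< K₀`, whose flights tile `[0,t]` sphere by sphere) `e^{λK₀} t` `+`
(energetic entries) `(N+1)⁻¹ ·` the energetic ledger. Between two of its own collisions a
sphere's speed is constant, so this is bookkeeping on hard-sphere trajectories; it is the
content of the registered stub `stub_tiling` and the pathwise input of `stub_ledger`. -/
def TilingBound (σ : ℝ) (N : ℕ) (Φ : Flow σ N) (t : ℝ) (K₀ : ℕ) (lam : ℝ) : Prop :=
  ∀ z ∈ Φ.good,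
    ∫ s in Icc 0 t, ∫ y, Real.exp (lam * ‖y.2‖ ^ 2) ∂(empiricalMeasure (Φ.flow s z)) ≤
      t * ∫ y, Real.exp (lam * ‖y.2‖ ^ 2) ∂(empiricalMeasure z) + Real.exp (lam * K₀) * t +
        ((N + 1 : ℕ) : ℝ)⁻¹ * energeticLedger σ N Φ z t K₀ lam

/-! ## The in-probability statements AT `(σ, profiles, Φ, …)` (all under the transported local
Gibbs law `localGibbsLaw σ a₀ u₀ θ₀ N (Φ N)`, exactly the crux's `P_N`) -/

/-- B1-event: the time-zero empirical exponential moment at rate `lam` exceeds `C₀` with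
probability `→ 0`. -/
def InitAt (σ : ℝ) (a₀ θ₀ : T3 → ℝ) (u₀ : T3 → V3) (Φ : Flows σ) (lam C₀ : ℝ) : Prop :=
  Tendsto (fun N : ℕ => localGibbsLaw σ a₀ u₀ θ₀ N (Φ N)
    {z | C₀ < ∫ y, Real.exp (lam * ‖y.2‖ ^ 2) ∂(empiricalMeasure z)}) atTop (𝓝 0)

/-- CAP-event at horizon `t` with constant `C`: verbatim the event of
`SpeedCapSurgery.MaxSpeedBoundLog` (some sphere faster than `C√log(N+2)` at some time in `[0,t]`). -/
def CapAt (σ : ℝ) (a₀ θ₀ : T3 → ℝ) (u₀ : T3 → V3) (Φ : Flows σ) (t C : ℝ) : Prop :=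
  Tendsto (fun N : ℕ => localGibbsLaw σ a₀ u₀ θ₀ N (Φ N)
    {z | ∃ r ∈ Icc 0 t, ∃ i, C * Real.sqrt (Real.log ((N : ℝ) + 2)) < ‖((Φ N).flow r z i).2‖})
    atTop (𝓝 0)

/-- (U♭)-event: some shell `K₀ ≤ K ≤ r log(N+2)` receives more than
`C_U (N+1) ν_N t (K+1) e^{−K/2Θ}` entries in `(0,t]`, with probability `→ 0`. -/
def BulkAt (σ : ℝ) (a₀ θ₀ : T3 → ℝ) (u₀ : T3 → V3) (Φ : Flows σ) (t r Θ : ℝ) (K₀ : ℕ)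
    (CU : ℝ) : Prop :=
  Tendsto (fun N : ℕ => localGibbsLaw σ a₀ u₀ θ₀ N (Φ N)
    {z | ∃ K : ℕ, K₀ ≤ K ∧ (K : ℝ) ≤ r * Real.log ((N : ℝ) + 2) ∧
      CU * (((N : ℝ) + 1) * nu σ N * t * ((K : ℝ) + 1) * Real.exp (-(K : ℝ) / (2 * Θ))) <
        (shellCount σ N (Φ N) z t K : ℝ)}) atTop (𝓝 0)

/-- (R)-event: the `e^{λE}`-weighted sum of `ν_N·soj` over energetic entries exceeds
`C_R (W_λ + (N+1) ν_N t)`, with probability `→ 0`. -/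
def RecollAt (σ : ℝ) (a₀ θ₀ : T3 → ℝ) (u₀ : T3 → V3) (Φ : Flows σ) (t lam : ℝ) (K₀ : ℕ)
    (CR : ℝ) : Prop :=
  Tendsto (fun N : ℕ => localGibbsLaw σ a₀ u₀ θ₀ N (Φ N)
    {z | CR * (entryWeight σ N (Φ N) z t K₀ lam + ((N : ℝ) + 1) * nu σ N * t) <
      nu σ N * energeticLedger σ N (Φ N) z t K₀ lam}) atTop (𝓝 0)

/-- The conclusion of (i) at `(σ, profiles, Φ, t)` for a GIVEN rate `lam` and constant `Cexp`:
verbatim the crux's event. -/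
def TimeAvgAt (σ : ℝ) (a₀ θ₀ : T3 → ℝ) (u₀ : T3 → V3) (Φ : Flows σ) (t lam Cexp : ℝ) : Prop :=
  Tendsto (fun N : ℕ => localGibbsLaw σ a₀ u₀ θ₀ N (Φ N)
    {z | Cexp < ∫ s in Icc 0 t, ∫ y, Real.exp (lam * ‖y.2‖ ^ 2)
      ∂(empiricalMeasure ((Φ N).flow s z))}) atTop (𝓝 0)

/-! ## Unfolding lemmas (the events by name are the events as written) -/

/-- The collision clock is positive for `0 < σ`. -/
theorem nu_pos {σ : ℝ} (hσ : 0 < σ) (N : ℕ) : 0 < nu σ N :=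
  mul_pos (pow_pos hσ 2) (Real.rpow_pos_of_pos (by positivity) _)

/-- The outgoing energy is nonnegative. -/
theorem postE_nonneg (σ : ℝ) (N : ℕ) (Φ : Flow σ N) (z : Cfg N) (τ : ℝ) (i : Fin (N + 1)) :
    0 ≤ postE σ N Φ z τ i :=
  sq_nonneg _

/-- `TimeAvgAt` is verbatim the crux's component-(i) event: for a family `Φ`, horizon `t`, rate
`lam` and constant `Cexp`, it is the `Tendsto` the crux asks for (so `∃ lam Cexp, 0 < lam ∧
TimeAvgAt …` is component (i) at `(σ, Φ, t)`). -/
theorem timeAvgAt_iff :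
    ∀ (σ : ℝ) (a₀ θ₀ : T3 → ℝ) (u₀ : T3 → V3) (Φ : Flows σ) (t lam Cexp : ℝ),
      TimeAvgAt σ a₀ θ₀ u₀ Φ t lam Cexp ↔
        Tendsto (fun N : ℕ => localGibbsLaw σ a₀ u₀ θ₀ N (Φ N)
          {z | Cexp < ∫ s in Icc 0 t, ∫ y, Real.exp (lam * ‖y.2‖ ^ 2)
            ∂(empiricalMeasure ((Φ N).flow s z))}) atTop (𝓝 0) :=
  fun _ _ _ _ _ _ _ _ => Iff.rfl

end Summit.AtomisticToContinuum.HydrodynamicLimit.Theorems.VisitLedgerUpscattering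

end
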